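import Literature.AlgebraicGeometry.HodgeTheory.HeckePrymF21WeilTwelvefoldDimension
import HarnessLib

/-!
# `exists_heckePrymDatum_F21`: the Weil type of the Hecke–Prym read on `H^{1,0}(C)` (Chevalley–Weil, holomorphic)

Fourth proof file of the named fact
`Literature.AlgebraicGeometry.HodgeTheory.exists_heckePrymDatum_F21` (`HeckePrymF21WeilTwelvefold`).
After `…Proofs` (the Hecke-algebra half), `…WeilType` (Weil CLASS from Weil TYPE, van Geemen 4.10)
and `…Dimension` (`dim P' = 12` from `H¹(J) ≅ H¹(C)`), this file transports the Weil TYPE of the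
Hecke–Prym `(P', φ')` down to the CURVE: granted the named fact
`Motives.isIso_bettiCohomology_map_abelJacobi`,

  `dim (ker(φ'^* - μ) ∩ H^{1,0}(P')) = dim (H¹(C)^τ ∩ ker(η_C - μ) ∩ H^{1,0}(C))`   (`μ ≠ 0`),

where `η_C = σ^* + (σ^*)² + (σ^*)⁴ - (σ^*)³ - (σ^*)⁵ - (σ^*)⁶` is the Hecke element (quadratic Gauss
sum) acting on `H¹(C(ℂ); ℂ)` (`finrank_eigenspace_inf_hodgeOneZero_heckePrym_eq`). This is the
dictionary "`H¹(P') = H¹(B)_τ`, `H¹(B) = H¹(J)/H¹(J)^σ`, `H¹(J) = H¹(C)`" of the fact's docstring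
([LangeRodriguez2022, §3.2 (3.5)–(3.6), §3.5 Cor. 3.5.9–3.5.10]), made Hodge-theoretic: the
pull-back `Ψ = (ι_{P'} ≫ ι_B)^* : H¹(J) ↠ H¹(P')` restricts to an ISOMORPHISM on
`K = ker e_N^* ∩ H¹(J)^{t}` which intertwines `η^*` with `φ'^*` and respects the Hodge
decompositions in both directions (pull-backs preserve Hodge types,
`IsOfHodgeType.map_of_isSmoothProjective`; types of components of vectors in kernels of pull-backs,
`eigenvector_components`), and `(f^P)^* : H¹(J) ≅ H¹(C)` does the same. Hence:

* `exists_heckePrymDatum_F21_of_isIso_of_curve` — **the named fact follows from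
  `isIso_bettiCohomology_map_abelJacobi` and the existence of a smooth projective complex curve `C`
  with a Jacobian of dimension `43`, fixed-point-free automorphisms `σ⁷ = 𝟙`, `τ³ = 𝟙`,
  `σ ≫ τ = τ ≫ σ ≫ σ`, and `dim (H¹(C)^τ ∩ ker(η_C - i√7) ∩ H^{1,0}(C)) = 6`** — i.e. from the
  `H¹` fact, Riemann's existence theorem for the generating vector `(σ, τ, 1; 1, 1, 1)` of `F₂₁`
  ([LangeRodriguez2022, Thm. 3.1.1]) with its Jacobian ([Milne1986JacobianVarieties]), and the
  HOLOMORPHIC Chevalley–Weil theorem `H^{1,0}(C) = 1 ⊕ 2·Reg(F₂₁)` ([ChevalleyWeil1934Integrale]),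
  which gives `6` (`η` acts by `+i√7` on `χ = Ind ψ₁` and by `-i√7` on `χ̄`; `2·Reg ⊃ 6χ`,
  `dim χ^τ = 1`).

Everything is proved; no definition, no named fact (D-0026).

## References

* [LangeRodriguez2022] H. Lange, R. E. Rodríguez, LNM 2310 (2022): Thm. 3.1.1 (PDF p. 52), §3.2
  (3.5)–(3.6) (PDF p. 56), §3.5 Cor. 3.5.9–3.5.10 (PDF pp. 70–71).
* [ChevalleyWeil1934Integrale] C. Chevalley, A. Weil, Abh. Math. Sem. Hamburg 10 (1934) 358–361.
* [VoisinHodgeI2002] C. Voisin, *Hodge Theory and Complex Algebraic Geometry I* (2002), §7.3.2,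
  Cor. 6.14.
* [Lange2023AbelianVarietiesC] H. Lange (2023), §4.1.1, Lemma 4.4.1, §4.5.2.
-/

noncomputable section

open CategoryTheory

namespace Literature.AlgebraicGeometry.HodgeTheory

open Literature.AlgebraicTopology.SingularHomology
open Literature.AlgebraicGeometry Literature.AlgebraicGeometry.Motives

universe u

/-! ### §1 Linear algebra: transporting `dim (eigenspace ∩ type piece)` along (partial) isomorphisms -/

section LinearAlgebra

variable {V U : Type*} [AddCommGroup V] [Module ℂ V] [AddCommGroup U] [Module ℂ U]

/-- **Injective type-preserving maps reflect types**: if `V = P ⊕ Q` (every vector is a sum),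
`F(P) ⊆ P'`, `F(Q) ⊆ Q'`, `P' ∩ Q' = 0` and `F` is injective on `Q`, then `F v ∈ P'` forces
`v ∈ P`. [cite: VoisinHodgeI2002, Cor. 6.14 and §7.3.2] -/
theorem mem_of_map_mem_of_types (F : V →ₗ[ℂ] U) {P Q : Submodule ℂ V} {P' Q' : Submodule ℂ U}
    (hdec : ∀ v : V, ∃ a b : V, a + b = v ∧ a ∈ P ∧ b ∈ Q)
    (hFP : ∀ v ∈ P, F v ∈ P') (hFQ : ∀ v ∈ Q, F v ∈ Q') (hPQ' : P' ⊓ Q' = ⊥)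
    (hinj : ∀ v ∈ Q, F v = 0 → v = 0) {v : V} (hv : F v ∈ P') : v ∈ P := by
  obtain ⟨a, b, hab, ha, hb⟩ := hdec v
  have hFb : F b ∈ P' ⊓ Q' := by
    refine ⟨?_, hFQ b hb⟩
    have e : F b = F v - F a := by rw [← hab, map_add]; abel
    rw [e]
    exact Submodule.sub_mem _ hv (hFP a ha)
  rw [hPQ', Submodule.mem_bot] at hFb
  have hb0 : b = 0 := hinj b hb hFb
  rw [← hab, hb0, add_zero]
  exact ha

/-- **Transport along an intertwining bijection**: for a bijective `F : V → U` with
`F ∘ T_V = T_U ∘ F`, `F ∘ E_V = E_U ∘ F`, `F(P_V) ⊆ P_U` and `F⁻¹(P_U) ⊆ P_V`,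
`dim (V^{T_V} ∩ ker(E_V - μ) ∩ P_V) = dim (U^{T_U} ∩ ker(E_U - μ) ∩ P_U)`. [folklore] -/
theorem finrank_ker_inf_eigenspace_inf_eq_of_bijective (F : V →ₗ[ℂ] U) (hF : Function.Bijective F)
    {TV EV : Module.End ℂ V} {TU EU : Module.End ℂ U} (hT : F ∘ₗ TV = TU ∘ₗ F)
    (hE : F ∘ₗ EV = EU ∘ₗ F) {PV : Submodule ℂ V} {PU : Submodule ℂ U}
    (hFP : ∀ v ∈ PV, F v ∈ PU) (hrefl : ∀ v, F v ∈ PU → v ∈ PV) (μ : ℂ) :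
    Module.finrank ℂ ↥(LinearMap.ker (TV - 1) ⊓ Module.End.eigenspace EV μ ⊓ PV) =
      Module.finrank ℂ ↥(LinearMap.ker (TU - 1) ⊓ Module.End.eigenspace EU μ ⊓ PU) := by
  let e : V ≃ₗ[ℂ] U := LinearEquiv.ofBijective F hF
  have he : (e : V →ₗ[ℂ] U) = F := rfl
  have hTv : ∀ v, F (TV v) = TU (F v) := fun v ↦ by
    simpa only [LinearMap.comp_apply] using LinearMap.congr_fun hT v
  have hEv : ∀ v, F (EV v) = EU (F v) := fun v ↦ by
    simpa only [LinearMap.comp_apply] using LinearMap.congr_fun hE v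
  have hmap : (LinearMap.ker (TV - 1) ⊓ Module.End.eigenspace EV μ ⊓ PV).map (e : V →ₗ[ℂ] U) =
      LinearMap.ker (TU - 1) ⊓ Module.End.eigenspace EU μ ⊓ PU := by
    rw [he]
    ext u
    simp only [Submodule.mem_map, Submodule.mem_inf, LinearMap.mem_ker, LinearMap.sub_apply,
      Module.End.one_apply, sub_eq_zero, Module.End.mem_eigenspace_iff]
    constructor
    · rintro ⟨v, ⟨⟨hvT, hvE⟩, hvP⟩, rfl⟩
      exact ⟨⟨by rw [← hTv, hvT], by rw [← hEv, hvE, map_smul]⟩, hFP v hvP⟩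
    · rintro ⟨⟨huT, huE⟩, huP⟩
      obtain ⟨v, rfl⟩ := hF.2 u
      refine ⟨v, ⟨⟨hF.1 ?_, hF.1 ?_⟩, hrefl v huP⟩, rfl⟩
      · rw [hTv, huT]
      · rw [hEv, huE, map_smul]
  rw [← hmap]
  exact (e.finrank_map_eq _).symm

/-- **Transport along an equivariant surjection that is an isomorphism on a sub-`K`.** Let
`Ψ : V → W` be linear, `K ≤ V` with `Ψ|_K` injective and onto `W`, `E ∈ End V` preserving `K` and
intertwined with `Φ ∈ End W` (`Φ ∘ Ψ = Ψ ∘ E`); let `V = P ⊕ Q` with `Ψ(P) ⊆ P'`, `Ψ(Q) ⊆ Q'`,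
`P' ∩ Q' = 0`, and such that the `Q`-component of every vector of `K` lies in `K`. Then
`dim (ker(Φ - μ) ∩ P') = dim (K ∩ ker(E - μ) ∩ P)` — `Ψ` restricts to an isomorphism between the two.
[cite: VoisinHodgeI2002, Cor. 6.14 and §7.3.2] -/
theorem finrank_eigenspace_inf_eq_of_isoOn {W : Type*} [AddCommGroup W] [Module ℂ W]
    (Ψ : V →ₗ[ℂ] W) (K : Submodule ℂ V) (hinj : ∀ k ∈ K, Ψ k = 0 → k = 0)
    (hsurj : ∀ w : W, ∃ k ∈ K, Ψ k = w) {E : Module.End ℂ V} {Φ : Module.End ℂ W}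
    (hEK : ∀ k ∈ K, E k ∈ K) (hcomm : Φ ∘ₗ Ψ = Ψ ∘ₗ E) {P Q : Submodule ℂ V}
    {P' Q' : Submodule ℂ W} (hdec : ∀ v : V, ∃ a b : V, a + b = v ∧ a ∈ P ∧ b ∈ Q)
    (hKQ : ∀ k ∈ K, ∀ a b : V, a + b = k → a ∈ P → b ∈ Q → b ∈ K)
    (hΨP : ∀ v ∈ P, Ψ v ∈ P') (hΨQ : ∀ v ∈ Q, Ψ v ∈ Q') (hPQ' : P' ⊓ Q' = ⊥) (μ : ℂ) :
    Module.finrank ℂ ↥(Module.End.eigenspace Φ μ ⊓ P') =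
      Module.finrank ℂ ↥(K ⊓ Module.End.eigenspace E μ ⊓ P) := by
  have hcv : ∀ v, Φ (Ψ v) = Ψ (E v) := fun v ↦ by
    simpa only [LinearMap.comp_apply] using LinearMap.congr_fun hcomm v
  -- `Ψ` maps the source into the target
  have hinto : ∀ v ∈ K ⊓ Module.End.eigenspace E μ ⊓ P, Ψ v ∈ Module.End.eigenspace Φ μ ⊓ P' := by
    rintro v ⟨⟨-, hvE⟩, hvP⟩
    have hvE' : E v = μ • v := Module.End.mem_eigenspace_iff.1 hvE
    exact ⟨Module.End.mem_eigenspace_iff.2 (by rw [hcv, hvE', map_smul]), hΨP v hvP⟩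
  -- the restricted map
  let f : ↥(K ⊓ Module.End.eigenspace E μ ⊓ P) →ₗ[ℂ] ↥(Module.End.eigenspace Φ μ ⊓ P') :=
    (Ψ.domRestrict _).codRestrict _ fun v ↦ hinto v v.2
  have hf : ∀ v, (f v : W) = Ψ v := fun v ↦ rfl
  refine (LinearEquiv.ofBijective f ⟨?_, ?_⟩).finrank_eq.symm
  · -- injective: `Ψ` is injective on `K`
    intro v₁ v₂ h
    have h' : Ψ (v₁ : V) = Ψ (v₂ : V) := by rw [← hf, ← hf, h]
    have hd : (v₁ : V) - v₂ ∈ K := Submodule.sub_mem _ v₁.2.1.1 v₂.2.1.1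
    have h0 : Ψ ((v₁ : V) - v₂) = 0 := by rw [map_sub, h', sub_self]
    exact Subtype.ext (sub_eq_zero.1 (hinj _ hd h0))
  · -- surjective
    rintro ⟨w, hwE, hwP⟩
    have hwE' : Φ w = μ • w := Module.End.mem_eigenspace_iff.1 hwE
    obtain ⟨k, hkK, rfl⟩ := hsurj w
    -- `k` is an eigenvector of `E`
    have hkE : E k = μ • k := by
      have hmem : E k - μ • k ∈ K := Submodule.sub_mem _ (hEK k hkK) (Submodule.smul_mem _ μ hkK)
      have h0 : Ψ (E k - μ • k) = 0 := by rw [map_sub, map_smul, ← hcv, hwE', sub_self]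
      exact sub_eq_zero.1 (hinj _ hmem h0)
    -- `k ∈ P`: its `Q`-component lies in `K` and maps to `P' ∩ Q' = 0`
    have hkP : k ∈ P := by
      obtain ⟨a, b, hab, ha, hb⟩ := hdec k
      have hbK : b ∈ K := hKQ k hkK a b hab ha hb
      have hΨb : Ψ b ∈ P' ⊓ Q' := by
        refine ⟨?_, hΨQ b hb⟩
        have e : Ψ b = Ψ k - Ψ a := by rw [← hab, map_add]; abel
        rw [e]
        exact Submodule.sub_mem _ hwP (hΨP a ha)
      rw [hPQ', Submodule.mem_bot] at hΨb
      have hb0 : b = 0 := hinj b hbK hΨb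
      rw [← hab, hb0, add_zero]
      exact ha
    exact ⟨⟨k, ⟨hkK, Module.End.mem_eigenspace_iff.2 hkE⟩, hkP⟩, Subtype.ext (hf _)⟩

end LinearAlgebra

/-! ### §2 The Weil type of `(P', φ')` read on `H^{1,0}(C)` -/

section Geometry

variable {C : Motives.SchemeOver ℂ} (𝒥 : Jacobian C)

/-- `(f ≫ g)^* = f^* ∘ g^*` on `H¹` of abelian varieties, linear-map form. [folklore] -/
theorem complexBetti_map_comp_one_hom_eq_comp {X Y Z : Motives.AbelianVariety ℂ} (f : X ⟶ Y) (g : Y ⟶ Z) :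
    (complexBetti.map (f ≫ g).hom.hom.hom 1).hom =
      (complexBetti.map f.hom.hom.hom 1).hom ∘ₗ (complexBetti.map g.hom.hom.hom 1).hom := by
  rw [complexBetti_map_comp_hom, ModuleCat.hom_comp]

/-- **The Hecke element on the Prym restricts the Hecke element on `J`**: from
`s_B ≫ ι_B = ι_B ≫ s`, `η_B ≫ ι_B = ι_B ≫ η` for `η = s + s² + s⁴ - s³ - s⁵ - s⁶`. [folklore] -/
theorem heckeElement_comp_kerComponentι {J : Motives.AbelianVariety ℂ} {s eN : J ⟶ J}
    {sB : Motives.AbelianVariety.kerComponent eN ⟶ Motives.AbelianVariety.kerComponent eN}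
    (hsB : sB ≫ Motives.AbelianVariety.kerComponentι eN = Motives.AbelianVariety.kerComponentι eN ≫ s) :
    (sB + sB ≫ sB + sB ≫ sB ≫ sB ≫ sB - sB ≫ sB ≫ sB - sB ≫ sB ≫ sB ≫ sB ≫ sB -
        sB ≫ sB ≫ sB ≫ sB ≫ sB ≫ sB) ≫ Motives.AbelianVariety.kerComponentι eN =
      Motives.AbelianVariety.kerComponentι eN ≫
        (s + s ≫ s + s ≫ s ≫ s ≫ s - s ≫ s ≫ s - s ≫ s ≫ s ≫ s ≫ s - s ≫ s ≫ s ≫ s ≫ s ≫ s) := by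
  simp only [Preadditive.add_comp, Preadditive.sub_comp, Preadditive.comp_add, Preadditive.comp_sub,
    Category.assoc, hsB, reassoc_of% hsB]

/-- **The Weil type of the Hecke–Prym `(P', φ')` equals the holomorphic Chevalley–Weil multiplicity
on the curve.** In the situation of `exists_heckePrymDatum_F21` (a smooth projective complex curve
`C` with a Jacobian `𝒥` of dimension `43`, fixed-point-free `σ⁷ = 𝟙`, `τ³ = 𝟙`,
`σ ≫ τ = τ ≫ σ ≫ σ`, `s = σ_*`, `t = τ_*`, `e_N = Σ_{i<7} sⁱ`, `B = (ker e_N)⁰`, `s_B`, `t_B` over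
`s`, `t`, `P' = (ker(𝟙_B - t_B))⁰`, `φ'` over `η_B`), granted `H¹(J(C)) ≅ H¹(C)` (the named fact
`Motives.isIso_bettiCohomology_map_abelJacobi`): for every `μ ≠ 0`,
`dim (ker(φ'^* - μ) ∩ H^{1,0}(P')) = dim (H¹(C)^τ ∩ ker(η_C - μ) ∩ H^{1,0}(C))`,
`η_C = σ^* + (σ^*)² + (σ^*)⁴ - (σ^*)³ - (σ^*)⁵ - (σ^*)⁶` — the dictionary
"`H¹(P') = H¹(B)^τ`, `H¹(B) = H¹(J)/H¹(J)^σ`, `H¹(J) = H¹(C)`" made compatible with `η` and with the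
Hodge decompositions (module docstring). [cite: LangeRodriguez2022, §3.2 (3.5)–(3.6) (PDF p. 56) and §3.5 Cor. 3.5.9–3.5.10 (PDF pp. 70–71)]
[cite: VoisinHodgeI2002, §7.3.2 and Cor. 6.14] [cite: Lange2023AbelianVarietiesC, §4.1.1 and Lemma 4.4.1] -/
theorem finrank_eigenspace_inf_hodgeOneZero_heckePrym_eq
    (hI : Motives.isIso_bettiCohomology_map_abelJacobi) {σ τ : C ⟶ C}
    (hC : Motives.IsSmoothProjective 1 C) (h43 : 𝒥.J.dim = 43)
    (hσ : σ ≫ σ ≫ σ ≫ σ ≫ σ ≫ σ ≫ σ = 𝟙 C) (hτ : τ ≫ τ ≫ τ = 𝟙 C) (hστ : σ ≫ τ = τ ≫ σ ≫ σ)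
    (hfree : ∀ P : Motives.ComplexPoints C, P ≫ σ ≠ P ∧ P ≫ τ ≠ P)
    {s t eN : 𝒥.J ⟶ 𝒥.J} (hs : s = 𝒥.pushforward 𝒥 σ) (ht : t = 𝒥.pushforward 𝒥 τ)
    (heN : eN = 𝟙 𝒥.J + s + s ≫ s + s ≫ s ≫ s + s ≫ s ≫ s ≫ s + s ≫ s ≫ s ≫ s ≫ s +
      s ≫ s ≫ s ≫ s ≫ s ≫ s)
    {sB tB : Motives.AbelianVariety.kerComponent eN ⟶ Motives.AbelianVariety.kerComponent eN}
    (hsB : sB ≫ Motives.AbelianVariety.kerComponentι eN = Motives.AbelianVariety.kerComponentι eN ≫ s)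
    (htB : tB ≫ Motives.AbelianVariety.kerComponentι eN = Motives.AbelianVariety.kerComponentι eN ≫ t)
    {φ' : Motives.AbelianVariety.kerComponent (𝟙 (Motives.AbelianVariety.kerComponent eN) - tB) ⟶
      Motives.AbelianVariety.kerComponent (𝟙 (Motives.AbelianVariety.kerComponent eN) - tB)}
    (hφ' : φ' ≫ Motives.AbelianVariety.kerComponentι (𝟙 (Motives.AbelianVariety.kerComponent eN) - tB) =
      Motives.AbelianVariety.kerComponentι (𝟙 (Motives.AbelianVariety.kerComponent eN) - tB) ≫
        (sB + sB ≫ sB + sB ≫ sB ≫ sB ≫ sB - sB ≫ sB ≫ sB - sB ≫ sB ≫ sB ≫ sB ≫ sB -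
          sB ≫ sB ≫ sB ≫ sB ≫ sB ≫ sB))
    (hP : Motives.IsSmoothProjective 12
      (Motives.AbelianVariety.kerComponent (𝟙 (Motives.AbelianVariety.kerComponent eN) - tB)).X)
    {μ : ℂ} (hμ : μ ≠ 0) :
    Module.finrank ℂ ↥(Module.End.eigenspace (complexBetti.map φ'.hom.hom.hom 1).hom μ ⊓ hodgeOneZero hP) =
      Module.finrank ℂ ↥(LinearMap.ker ((complexBetti.map τ 1).hom - 1) ⊓
        Module.End.eigenspace ((complexBetti.map σ 1).hom + (complexBetti.map σ 1).hom ^ 2 +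
            (complexBetti.map σ 1).hom ^ 4 - (complexBetti.map σ 1).hom ^ 3 -
            (complexBetti.map σ 1).hom ^ 5 - (complexBetti.map σ 1).hom ^ 6) μ ⊓
          hodgeOneZero hC) := by
  haveI := finite_complexBetti_abelianVariety 𝒥.J 1
  haveI := finite_complexBetti_abelianVariety (Motives.AbelianVariety.kerComponent eN) 1
  haveI := finite_complexBetti_abelianVariety
    (Motives.AbelianVariety.kerComponent (𝟙 (Motives.AbelianVariety.kerComponent eN) - tB)) 1
  haveI := finite_complexBetti_of_isSmoothProjective hC 1
  -- the Hecke element on `J`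
  set ηJ : 𝒥.J ⟶ 𝒥.J := s + s ≫ s + s ≫ s ≫ s ≫ s - s ≫ s ≫ s - s ≫ s ≫ s ≫ s ≫ s -
    s ≫ s ≫ s ≫ s ≫ s ≫ s with hηJdef
  -- the operators on `V = H¹(J(ℂ); ℂ)`
  set S : Module.End ℂ (complexBetti 𝒥.J.X 1) := (complexBetti.map s.hom.hom.hom 1).hom with hSdef
  set T : Module.End ℂ (complexBetti 𝒥.J.X 1) := (complexBetti.map t.hom.hom.hom 1).hom with hTdef
  set N : Module.End ℂ (complexBetti 𝒥.J.X 1) := (complexBetti.map eN.hom.hom.hom 1).hom with hNdef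
  set E : Module.End ℂ (complexBetti 𝒥.J.X 1) := (complexBetti.map ηJ.hom.hom.hom 1).hom with hEdef
  set Ψ : complexBetti 𝒥.J.X 1 →ₗ[ℂ] complexBetti (Motives.AbelianVariety.kerComponent (𝟙 (Motives.AbelianVariety.kerComponent eN) - tB)).X 1 :=
    (complexBetti.map ((Motives.AbelianVariety.kerComponentι (𝟙 (Motives.AbelianVariety.kerComponent eN) - tB)) ≫ (Motives.AbelianVariety.kerComponentι eN)).hom.hom.hom 1).hom with hΨdef
  set Φ : Module.End ℂ (complexBetti (Motives.AbelianVariety.kerComponent (𝟙 (Motives.AbelianVariety.kerComponent eN) - tB)).X 1) := (complexBetti.map φ'.hom.hom.hom 1).hom with hΦdef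
  /- 1. Variety-level identities -/
  have h7J : s ≫ s ≫ s ≫ s ≫ s ≫ s ≫ s = 𝟙 𝒥.J := pushforward_comp_pow_seven_of_pow_seven 𝒥 hσ hs
  have ht3 : t ≫ t ≫ t = 𝟙 𝒥.J := by
    simp only [ht, ← Jacobian.pushforward_comp, hτ, Jacobian.pushforward_id]
  have hst : s ≫ t = t ≫ s ≫ s := by
    simp only [hs, ht, ← Jacobian.pushforward_comp, hστ]
  have hNt : t ≫ eN = eN ≫ t := normElement_comm_of_conj h7J hst heN
  have hηt : t ≫ ηJ = ηJ ≫ t := weilOperator_comm_of_conj h7J hst hηJdef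
  have hNs : eN ≫ s = eN := normElement_comp_eq_of_comp_pow_seven h7J heN
  have hNη : eN ≫ ηJ = 0 := by
    rw [hηJdef]
    simp only [Preadditive.comp_add, Preadditive.comp_sub, reassoc_of% hNs, hNs]
    abel
  have hηBι : (sB + sB ≫ sB + sB ≫ sB ≫ sB ≫ sB - sB ≫ sB ≫ sB - sB ≫ sB ≫ sB ≫ sB ≫ sB -
      sB ≫ sB ≫ sB ≫ sB ≫ sB ≫ sB) ≫ (Motives.AbelianVariety.kerComponentι eN) = (Motives.AbelianVariety.kerComponentι eN) ≫ ηJ := heckeElement_comp_kerComponentι hsB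
  have hι't : (Motives.AbelianVariety.kerComponentι (𝟙 (Motives.AbelianVariety.kerComponent eN) - tB)) ≫ tB = (Motives.AbelianVariety.kerComponentι (𝟙 (Motives.AbelianVariety.kerComponent eN) - tB)) := by
    have h := Motives.AbelianVariety.kerComponentι_comp (𝟙 (Motives.AbelianVariety.kerComponent eN) - tB)
    rw [Preadditive.comp_sub, Category.comp_id, sub_eq_zero] at h
    exact h.symm
  have hιιt : ((Motives.AbelianVariety.kerComponentι (𝟙 (Motives.AbelianVariety.kerComponent eN) - tB)) ≫ (Motives.AbelianVariety.kerComponentι eN)) ≫ t = (Motives.AbelianVariety.kerComponentι (𝟙 (Motives.AbelianVariety.kerComponent eN) - tB)) ≫ (Motives.AbelianVariety.kerComponentι eN) := by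
    rw [Category.assoc, ← htB, ← Category.assoc, hι't]
  have hιιN : ((Motives.AbelianVariety.kerComponentι (𝟙 (Motives.AbelianVariety.kerComponent eN) - tB)) ≫ (Motives.AbelianVariety.kerComponentι eN)) ≫ eN = 0 := by
    rw [Category.assoc, Motives.AbelianVariety.kerComponentι_comp, Limits.comp_zero]
  have hφιι : φ' ≫ ((Motives.AbelianVariety.kerComponentι (𝟙 (Motives.AbelianVariety.kerComponent eN) - tB)) ≫ (Motives.AbelianVariety.kerComponentι eN)) = ((Motives.AbelianVariety.kerComponentι (𝟙 (Motives.AbelianVariety.kerComponent eN) - tB)) ≫ (Motives.AbelianVariety.kerComponentι eN)) ≫ ηJ := by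
    rw [← Category.assoc, hφ', Category.assoc, hηBι, Category.assoc]
  /- 2. The induced identities on `H¹` -/
  have hmap₂ : ∀ {X Y Z : Motives.AbelianVariety ℂ} (f : X ⟶ Y) (g : Y ⟶ Z),
      (complexBetti.map (f ≫ g).hom.hom.hom 1).hom =
        (complexBetti.map f.hom.hom.hom 1).hom ∘ₗ (complexBetti.map g.hom.hom.hom 1).hom :=
    fun f g ↦ complexBetti_map_comp_one_hom_eq_comp f g
  have hS7 : S ^ 7 = 1 := complexBetti_map_one_hom_pow_seven h7J
  have hT3 : T ^ 3 = 1 := complexBetti_map_one_hom_pow_three ht3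
  have hST : S * T = T * S ^ 2 := by
    have h := congrArg (fun u : 𝒥.J ⟶ 𝒥.J => (complexBetti.map u.hom.hom.hom 1).hom) hst
    dsimp only at h
    rw [complexBetti_map_comp_one_hom_eq_mul, complexBetti_map_comp_one_hom_eq_mul,
      complexBetti_map_comp_one_hom_eq_mul] at h
    rw [hSdef, hTdef, h, pow_two]
  have hTN : T * N = N * T := by
    have h := congrArg (fun u : 𝒥.J ⟶ 𝒥.J => (complexBetti.map u.hom.hom.hom 1).hom) hNt
    dsimp only at h
    rw [complexBetti_map_comp_one_hom_eq_mul, complexBetti_map_comp_one_hom_eq_mul] at h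
    exact h
  have hTE : T * E = E * T := by
    have h := congrArg (fun u : 𝒥.J ⟶ 𝒥.J => (complexBetti.map u.hom.hom.hom 1).hom) hηt
    dsimp only at h
    rw [complexBetti_map_comp_one_hom_eq_mul, complexBetti_map_comp_one_hom_eq_mul] at h
    exact h
  have hNE : N * E = 0 := by
    have h := congrArg (fun u : 𝒥.J ⟶ 𝒥.J => (complexBetti.map u.hom.hom.hom 1).hom) hNη
    dsimp only at h
    rw [complexBetti_map_comp_one_hom_eq_mul, complexBetti_map_zero_one, ModuleCat.hom_zero] at h
    exact h
  have hNsum : N = ∑ i ∈ Finset.range 7, S ^ i := by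
    rw [hNdef, heN]
    exact complexBetti_map_normElement₇_one_hom s
  have hSN : S * N = N := by rw [hNsum]; exact mul_sum_range_pow_eq_of_pow_eq_one hS7
  have hSjN : ∀ j : ℕ, S ^ j * N = N := by
    intro j; induction j with
    | zero => rw [pow_zero, one_mul]
    | succ j ih => rw [pow_succ, mul_assoc, hSN, ih]
  have hNN : N * N = (7 : ℂ) • N := by
    nth_rewrite 1 [hNsum]
    rw [Finset.sum_mul, Finset.sum_congr rfl fun j _ => hSjN j, Finset.sum_const, Finset.card_range,
      ← Nat.cast_smul_eq_nsmul ℂ]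
    norm_num
  have hΨT : Ψ ∘ₗ T = Ψ := by
    have h := congrArg (fun u : (Motives.AbelianVariety.kerComponent (𝟙 (Motives.AbelianVariety.kerComponent eN) - tB)) ⟶ 𝒥.J => (complexBetti.map u.hom.hom.hom 1).hom) hιιt
    dsimp only at h
    rw [hmap₂ ((Motives.AbelianVariety.kerComponentι (𝟙 (Motives.AbelianVariety.kerComponent eN) - tB)) ≫ (Motives.AbelianVariety.kerComponentι eN)) t] at h
    exact h
  have hΨN : Ψ ∘ₗ N = 0 := by
    have h := congrArg (fun u : (Motives.AbelianVariety.kerComponent (𝟙 (Motives.AbelianVariety.kerComponent eN) - tB)) ⟶ 𝒥.J => (complexBetti.map u.hom.hom.hom 1).hom) hιιN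
    dsimp only at h
    rw [hmap₂ ((Motives.AbelianVariety.kerComponentι (𝟙 (Motives.AbelianVariety.kerComponent eN) - tB)) ≫ (Motives.AbelianVariety.kerComponentι eN)) eN, complexBetti_map_zero_one, ModuleCat.hom_zero] at h
    exact h
  have hΦΨ : Φ ∘ₗ Ψ = Ψ ∘ₗ E := by
    have h := congrArg (fun u : (Motives.AbelianVariety.kerComponent (𝟙 (Motives.AbelianVariety.kerComponent eN) - tB)) ⟶ 𝒥.J => (complexBetti.map u.hom.hom.hom 1).hom) hφιι
    dsimp only at h
    rw [hmap₂ φ' ((Motives.AbelianVariety.kerComponentι (𝟙 (Motives.AbelianVariety.kerComponent eN) - tB)) ≫ (Motives.AbelianVariety.kerComponentι eN)), hmap₂ ((Motives.AbelianVariety.kerComponentι (𝟙 (Motives.AbelianVariety.kerComponent eN) - tB)) ≫ (Motives.AbelianVariety.kerComponentι eN)) ηJ] at h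
    exact h
  have hΨsurj : Function.Surjective Ψ := by
    rw [hΨdef, hmap₂ (Motives.AbelianVariety.kerComponentι (𝟙 (Motives.AbelianVariety.kerComponent eN) - tB)) (Motives.AbelianVariety.kerComponentι eN), LinearMap.coe_comp]
    exact (complexBetti_map_one_surjective_of_isClosedImmersion (Motives.AbelianVariety.kerComponentι (𝟙 (Motives.AbelianVariety.kerComponent eN) - tB))).comp
      (complexBetti_map_one_surjective_of_isClosedImmersion (Motives.AbelianVariety.kerComponentι eN))
  /- 3. Dimensions on `V`: `dim V = 86`, `dim V^S = 14`, `dim V^T = 30`, `dim (V^S ∩ V^T) = 6` -/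
  obtain ⟨Pt⟩ : Nonempty (Motives.AlgPoints C ℂ) := Motives.nonempty_algPoints_of_isSmoothProjective hC
  set F : complexBetti 𝒥.J.X 1 →ₗ[ℂ] complexBetti C 1 := (complexBetti.map (𝒥.abelJacobi Pt) 1).hom
    with hFdef
  have hbij : Function.Bijective F := bijective_complexBetti_map_abelJacobi 𝒥 hI hC Pt
  have h86 : Module.finrank ℂ (complexBetti 𝒥.J.X 1) = 86 := by
    rw [Motives.AbelianVariety.finrank_complexBetti_one, h43]
  have hbC : Module.finrank ℂ (complexBetti C 1) = 86 := by
    rw [← h86]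
    exact (LinearEquiv.ofBijective F hbij).finrank_eq.symm
  have hFS : (complexBetti.map σ 1).hom ∘ₗ F = F ∘ₗ S := by
    have hsq := complexBetti_map_pushforward_comp_map_abelJacobi 𝒥 σ Pt 1
    rw [← hs] at hsq
    rw [hSdef, hFdef, ← ModuleCat.hom_comp, ← hsq, ModuleCat.hom_comp]
  have hFT : (complexBetti.map τ 1).hom ∘ₗ F = F ∘ₗ T := by
    have hsq := complexBetti_map_pushforward_comp_map_abelJacobi 𝒥 τ Pt 1
    rw [← ht] at hsq
    rw [hTdef, hFdef, ← ModuleCat.hom_comp, ← hsq, ModuleCat.hom_comp]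
  have hS14 : Module.finrank ℂ (LinearMap.ker (S - 1)) = 14 := by
    have hfix := finrank_ker_sub_one_eq_of_comm (complexBetti.map σ 1).hom S F hbij.1 hFS
      (fun v _ => hbij.2 v)
    have hcurve := seven_mul_finrank_ker_sub_one_eq hC σ hσ (fun Q => (hfree Q).1)
    rw [hbC, ← hfix] at hcurve
    omega
  have hT30 : Module.finrank ℂ (LinearMap.ker (T - 1)) = 30 := by
    have hfix := finrank_ker_sub_one_eq_of_comm (complexBetti.map τ 1).hom T F hbij.1 hFT
      (fun v _ => hbij.2 v)
    have hcurve := three_mul_finrank_ker_sub_one_eq hC τ hτ (fun Q => (hfree Q).2)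
    rw [hbC, ← hfix] at hcurve
    omega
  have h6 : Module.finrank ℂ ↥(LinearMap.ker (S - 1) ⊓ LinearMap.ker (T - 1)) = 6 := by
    have h := twentyOne_mul_finrank_inf_add hS7 hT3 hST
    rw [h86, hS14, hT30] at h
    omega
  /- 4. `K = ker N ∩ V^T`: the averaging decomposition, `dim K = 24`, `Ψ|_K` is onto and into -/
  set K : Submodule ℂ (complexBetti 𝒥.J.X 1) := LinearMap.ker N ⊓ LinearMap.ker (T - 1) with hKdef
  -- averaging over `⟨T⟩` and the decomposition `v̄ = u + k`
  have hTpowΨ : ∀ (j : ℕ) (v : complexBetti 𝒥.J.X 1), Ψ ((T ^ j) v) = Ψ v := by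
    intro j; induction j with
    | zero => intro v; rfl
    | succ j ih => intro v; rw [pow_succ', Module.End.mul_apply,
        show Ψ (T ((T ^ j) v)) = (Ψ ∘ₗ T) ((T ^ j) v) from rfl, hΨT, ih]
  have hdecomp : ∀ v : complexBetti 𝒥.J.X 1, T v = v →
      ∃ u k : complexBetti 𝒥.J.X 1, u + k = v ∧ u ∈ LinearMap.ker (S - 1) ⊓ LinearMap.ker (T - 1) ∧
        k ∈ K ∧ Ψ k = Ψ v := by
    intro v hv
    refine ⟨(7 : ℂ)⁻¹ • N v, v - (7 : ℂ)⁻¹ • N v, by abel, ?_, ?_, ?_⟩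
    · rw [Submodule.mem_inf]
      refine ⟨?_, ?_⟩
      · rw [LinearMap.mem_ker, LinearMap.sub_apply, Module.End.one_apply, sub_eq_zero, map_smul,
          ← Module.End.mul_apply, hSN]
      · rw [LinearMap.mem_ker, LinearMap.sub_apply, Module.End.one_apply, sub_eq_zero, map_smul,
          ← Module.End.mul_apply, hTN, Module.End.mul_apply, hv]
    · rw [hKdef, Submodule.mem_inf]
      refine ⟨?_, ?_⟩
      · rw [LinearMap.mem_ker, map_sub, map_smul, ← Module.End.mul_apply, hNN, LinearMap.smul_apply,
          smul_smul, inv_mul_cancel₀ (by norm_num : (7 : ℂ) ≠ 0), one_smul, sub_self]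
      · rw [LinearMap.mem_ker, LinearMap.sub_apply, Module.End.one_apply, sub_eq_zero, map_sub, map_smul,
          ← Module.End.mul_apply, hTN, Module.End.mul_apply, hv]
    · rw [map_sub, map_smul, show Ψ (N v) = (Ψ ∘ₗ N) v from rfl, hΨN, LinearMap.zero_apply,
        smul_zero, sub_zero]
  have hsurjK : ∀ w : complexBetti (Motives.AbelianVariety.kerComponent (𝟙 (Motives.AbelianVariety.kerComponent eN) - tB)).X 1, ∃ k ∈ K, Ψ k = w := by
    intro w
    obtain ⟨v, rfl⟩ := hΨsurj w
    -- average `v`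
    set vbar : complexBetti 𝒥.J.X 1 := (3 : ℂ)⁻¹ • ∑ j ∈ Finset.range 3, (T ^ j) v with hvbar
    have hvfix : T vbar = vbar := by
      rw [hvbar, map_smul, map_sum]
      congr 1
      have := congrArg (fun B : Module.End ℂ (complexBetti 𝒥.J.X 1) => B v)
        (sum_range_pow_succ_eq_of_pow_eq_one hT3)
      simp only [LinearMap.sum_apply] at this
      rw [← this]
      exact Finset.sum_congr rfl fun j _ => by rw [pow_succ', Module.End.mul_apply]
    have hΨvbar : Ψ vbar = Ψ v := by
      rw [hvbar, map_smul, map_sum, Finset.sum_congr rfl fun j _ => hTpowΨ j v, Finset.sum_const,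
        Finset.card_range, ← Nat.cast_smul_eq_nsmul ℂ, smul_smul]
      norm_num
    obtain ⟨u, k, -, -, hkK, hΨk⟩ := hdecomp vbar hvfix
    exact ⟨k, hkK, hΨk.trans hΨvbar⟩
  have hK24 : Module.finrank ℂ K = 24 := by
    -- `V^T = (V^S ∩ V^T) ⊕ K`
    have hsup : LinearMap.ker (T - 1) = (LinearMap.ker (S - 1) ⊓ LinearMap.ker (T - 1)) ⊔ K := by
      refine le_antisymm (fun v hv ↦ ?_) (sup_le inf_le_right inf_le_right)
      rw [LinearMap.mem_ker, LinearMap.sub_apply, Module.End.one_apply, sub_eq_zero] at hv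
      obtain ⟨u, k, huk, hu, hk, -⟩ := hdecomp v hv
      rw [← huk]
      exact Submodule.add_mem_sup hu hk
    have hdisj : (LinearMap.ker (S - 1) ⊓ LinearMap.ker (T - 1)) ⊓ K = ⊥ := by
      rw [eq_bot_iff]
      intro v hv
      rw [hKdef, Submodule.mem_inf, Submodule.mem_inf, Submodule.mem_inf] at hv
      obtain ⟨⟨hvS, -⟩, hvN, -⟩ := hv
      rw [Submodule.mem_bot]
      have hvS' : S v = v := by
        simpa only [LinearMap.mem_ker, LinearMap.sub_apply, Module.End.one_apply, sub_eq_zero] using hvS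
      have hvN' : N v = 0 := hvN
      have hSj : ∀ j : ℕ, (S ^ j) v = v := by
        intro j; induction j with
        | zero => rfl
        | succ j ih => rw [pow_succ, Module.End.mul_apply, hvS', ih]
      have h7v : N v = (7 : ℂ) • v := by
        rw [hNsum, LinearMap.sum_apply, Finset.sum_congr rfl fun j _ => hSj j, Finset.sum_const,
          Finset.card_range, ← Nat.cast_smul_eq_nsmul ℂ]
        norm_num
      rw [h7v, smul_eq_zero] at hvN'
      exact hvN'.resolve_left (by norm_num)
    have h := Submodule.finrank_sup_add_finrank_inf_eq (LinearMap.ker (S - 1) ⊓ LinearMap.ker (T - 1)) K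
    rw [← hsup, hdisj, finrank_bot, add_zero, hT30, h6] at h
    omega
  have hP24 : Module.finrank ℂ (complexBetti (Motives.AbelianVariety.kerComponent (𝟙 (Motives.AbelianVariety.kerComponent eN) - tB)).X 1) = 24 := by
    rw [Motives.AbelianVariety.finrank_complexBetti_one,
      dim_kerComponent_id_sub_eq_twelve_of_isIso 𝒥 hI hC h43 hσ hτ hστ hfree hs ht heN htB]
  have hinjK : ∀ k ∈ K, Ψ k = 0 → k = 0 := by
    have hsurj' : Function.Surjective (Ψ.domRestrict K) := by
      intro w
      obtain ⟨k, hk, rfl⟩ := hsurjK w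
      exact ⟨⟨k, hk⟩, rfl⟩
    have hinj' : Function.Injective (Ψ.domRestrict K) :=
      (LinearMap.injective_iff_surjective_of_finrank_eq_finrank (hK24.trans hP24.symm)).2 hsurj'
    intro k hk h0
    have h : (Ψ.domRestrict K) ⟨k, hk⟩ = (Ψ.domRestrict K) 0 := by
      rw [map_zero]; exact h0
    exact congrArg Subtype.val (hinj' h)
  have hEK : ∀ k ∈ K, E k ∈ K := by
    intro k hk
    rw [hKdef, Submodule.mem_inf] at hk ⊢
    obtain ⟨-, hkT⟩ := hk
    have hkT' : T k = k := by
      simpa only [LinearMap.mem_ker, LinearMap.sub_apply, Module.End.one_apply, sub_eq_zero] using hkT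
    refine ⟨?_, ?_⟩
    · rw [LinearMap.mem_ker, ← Module.End.mul_apply, hNE, LinearMap.zero_apply]
    · rw [LinearMap.mem_ker, LinearMap.sub_apply, Module.End.one_apply, sub_eq_zero, ← Module.End.mul_apply,
        hTE, Module.End.mul_apply, hkT']
  /- 5. Hodge types on `J` and `P'` -/
  have hJ : Motives.IsSmoothProjective 43 𝒥.J.X := Motives.isSmoothProjective_of_dim_eq' h43
  have hKQ : ∀ k ∈ K, ∀ a b : complexBetti 𝒥.J.X 1, a + b = k → a ∈ hodgeOneZero hJ →
      b ∈ hodgeZeroOne hJ → b ∈ K := by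
    intro k hk a b hab ha hb
    rw [hKdef, Submodule.mem_inf] at hk ⊢
    obtain ⟨hkN, hkT⟩ := hk
    have hkN' : (complexBetti.map eN.hom.hom.hom 1).hom k = (0 : ℂ) • k := by
      rw [zero_smul]; exact hkN
    have hkT' : (complexBetti.map t.hom.hom.hom 1).hom k = (1 : ℂ) • k := by
      rw [one_smul]
      simpa only [LinearMap.mem_ker, LinearMap.sub_apply, Module.End.one_apply, sub_eq_zero] using hkT
    obtain ⟨-, hbN⟩ := eigenvector_components hJ eN.hom.hom.hom 0 hkN' hab ha hb
    obtain ⟨-, hbT⟩ := eigenvector_components hJ t.hom.hom.hom 1 hkT' hab ha hb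
    refine ⟨?_, ?_⟩
    · rw [LinearMap.mem_ker]
      rw [zero_smul] at hbN
      exact hbN
    · rw [LinearMap.mem_ker, LinearMap.sub_apply, Module.End.one_apply, sub_eq_zero]
      rw [one_smul] at hbT
      exact hbT
  have hΨP : ∀ v ∈ hodgeOneZero hJ, Ψ v ∈ hodgeOneZero hP := fun v hv ↦
    IsOfHodgeType.map_of_isSmoothProjective hv hP hJ ((Motives.AbelianVariety.kerComponentι (𝟙 (Motives.AbelianVariety.kerComponent eN) - tB)) ≫ (Motives.AbelianVariety.kerComponentι eN)).hom.hom.hom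
  have hΨQ : ∀ v ∈ hodgeZeroOne hJ, Ψ v ∈ hodgeZeroOne hP := fun v hv ↦
    IsOfHodgeType.map_of_isSmoothProjective hv hP hJ ((Motives.AbelianVariety.kerComponentι (𝟙 (Motives.AbelianVariety.kerComponent eN) - tB)) ≫ (Motives.AbelianVariety.kerComponentι eN)).hom.hom.hom
  have hdecJ : ∀ v : complexBetti 𝒥.J.X 1, ∃ a b, a + b = v ∧ a ∈ hodgeOneZero hJ ∧ b ∈ hodgeZeroOne hJ :=
    fun v ↦ exists_add_eq_of_isOfHodgeType_one hJ v
  /- 6. Transport along `Ψ|_K`: `H¹(P')` versus `K` -/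
  have step1 := finrank_eigenspace_inf_eq_of_isoOn Ψ K hinjK hsurjK hEK hΦΨ hdecJ hKQ hΨP hΨQ
    (hodgeOneZero_inf_hodgeZeroOne hP) μ
  -- `K ∩ ker(E - μ) = V^T ∩ ker(E - μ)` for `μ ≠ 0` (`N ∘ E = 0`)
  have step2 : K ⊓ Module.End.eigenspace E μ ⊓ hodgeOneZero hJ =
      LinearMap.ker (T - 1) ⊓ Module.End.eigenspace E μ ⊓ hodgeOneZero hJ := by
    ext v
    simp only [Submodule.mem_inf, hKdef]
    constructor
    · rintro ⟨⟨⟨-, hvT⟩, hvE⟩, hvP⟩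
      exact ⟨⟨hvT, hvE⟩, hvP⟩
    · rintro ⟨⟨hvT, hvE⟩, hvP⟩
      refine ⟨⟨⟨?_, hvT⟩, hvE⟩, hvP⟩
      have hvE' : E v = μ • v := Module.End.mem_eigenspace_iff.1 hvE
      rw [LinearMap.mem_ker]
      have h : N (E v) = 0 := by rw [← Module.End.mul_apply, hNE, LinearMap.zero_apply]
      rw [hvE', map_smul, smul_eq_zero] at h
      exact h.resolve_left hμ
  /- 7. Transport along `(f^P)^*`: `V` versus `H¹(C)` -/
  set A : Module.End ℂ (complexBetti C 1) := (complexBetti.map σ 1).hom with hAdef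
  have hE : E = S + S ^ 2 + S ^ 4 - S ^ 3 - S ^ 5 - S ^ 6 := by
    rw [hEdef, hηJdef, complexBetti_map_sub_one, complexBetti_map_sub_one, complexBetti_map_sub_one,
      complexBetti_map_add_one, complexBetti_map_add_one]
    simp only [ModuleCat.hom_sub, ModuleCat.hom_add]
    repeat rw [complexBetti_map_comp_one_hom_eq_mul]
    rw [← hSdef]
    noncomm_ring
  have hFSj : ∀ j : ℕ, F ∘ₗ (S ^ j) = (A ^ j) ∘ₗ F := fun j ↦
    comp_pow_eq_pow_comp_of_comp_eq hFS.symm j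
  have hFE : F ∘ₗ E = (A + A ^ 2 + A ^ 4 - A ^ 3 - A ^ 5 - A ^ 6) ∘ₗ F := by
    rw [hE]
    simp only [LinearMap.comp_add, LinearMap.comp_sub, LinearMap.add_comp, LinearMap.sub_comp]
    rw [hFSj 2, hFSj 3, hFSj 4, hFSj 5, hFSj 6, ← hFS]
  have hFP : ∀ v ∈ hodgeOneZero hJ, F v ∈ hodgeOneZero hC := fun v hv ↦
    IsOfHodgeType.map_of_isSmoothProjective hv hC hJ (𝒥.abelJacobi Pt)
  have hFQ : ∀ v ∈ hodgeZeroOne hJ, F v ∈ hodgeZeroOne hC := fun v hv ↦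
    IsOfHodgeType.map_of_isSmoothProjective hv hC hJ (𝒥.abelJacobi Pt)
  have hrefl : ∀ v, F v ∈ hodgeOneZero hC → v ∈ hodgeOneZero hJ := fun v hv ↦
    mem_of_map_mem_of_types F hdecJ hFP hFQ (hodgeOneZero_inf_hodgeZeroOne hC)
      (fun w _ hw ↦ hbij.1 (by rw [hw, map_zero])) hv
  have step3 := finrank_ker_inf_eigenspace_inf_eq_of_bijective F hbij hFT.symm hFE hFP hrefl μ
  rw [step1, step2, step3]

end Geometry

/-! ### §3 Assembly: the named fact from `H¹(J) ≅ H¹(C)` and the `F₂₁`-curve with its holomorphic datum -/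

section Assembly

/-- **`exists_heckePrymDatum_F21` from `isIso_bettiCohomology_map_abelJacobi` and an étale
`F₂₁`-curve of genus `43` with its Jacobian and its HOLOMORPHIC Chevalley–Weil datum.** Granted the
named fact `Motives.isIso_bettiCohomology_map_abelJacobi` (`H¹(J(C)) ≅ H¹(C)`): if there is a smooth
projective complex curve `C` with a Jacobian `𝒥` of dimension `43` (Jacobians exist,
[Milne1986JacobianVarieties]; `Motives.nonempty_jacobian_of_isSmoothProjective`) and
fixed-point-free automorphisms `σ⁷ = 𝟙`, `τ³ = 𝟙`, `σ ≫ τ = τ ≫ σ ≫ σ` — an étale `F₂₁`-cover of a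
genus-3 curve, which exists by Riemann's existence theorem for the generating vector
`(σ, τ, 1; 1, 1, 1)` of `F₂₁` of type `(3; —)` ([LangeRodriguez2022, Thm. 3.1.1]) — such that
**`dim (H¹(C)^τ ∩ ker(η_C - i√7) ∩ H^{1,0}(C)) = 6`** for the Hecke element
`η_C = σ^* + (σ^*)² + (σ^*)⁴ - (σ^*)³ - (σ^*)⁵ - (σ^*)⁶` on `H¹(C(ℂ); ℂ)` — the holomorphic
Chevalley–Weil theorem `H^{1,0}(C) = 1 ⊕ 2·Reg(F₂₁)` ([ChevalleyWeil1934Integrale]; `η` acts by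
`+i√7` on `6χ ⊂ 2·Reg`, `χ = Ind_N^{F₂₁} ψ₁`, and `dim χ^τ = 1`) — THEN the named fact holds:
Weil type `(6, 6)` of `(P', φ')` is `finrank_eigenspace_inf_hodgeOneZero_heckePrym_eq` (this
file), `dim P' = 12` and the rest are `exists_heckePrymDatum_F21_of_isIso_of_weilType`
(`…Dimension`, `…WeilType`, `…Proofs`). This is the complete reduction of the fact to the
classical inputs the tree lacks, at the level of the curve.
[cite: LangeRodriguez2022, Thm. 3.1.1 (PDF p. 52), §3.2 (3.5)–(3.6) (PDF p. 56) and §3.5 Cor. 3.5.9–3.5.10 (PDF pp. 70–71)]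
[cite: ChevalleyWeil1934Integrale, Satz (pp. 358–361)]
[cite: vanGeemen1994HodgeAV, 4.9–4.10 (PDF p. 218) and Lemma 5.2 (6) (PDF p. 220)] -/
theorem exists_heckePrymDatum_F21_of_isIso_of_curve
    (hI : Motives.isIso_bettiCohomology_map_abelJacobi)
    (h : ∃ (C : SchemeOver ℂ) (hC : IsSmoothProjective 1 C) (𝒥 : Jacobian C) (σ τ : C ⟶ C),
      𝒥.J.dim = 43 ∧
      σ ≫ σ ≫ σ ≫ σ ≫ σ ≫ σ ≫ σ = 𝟙 C ∧ τ ≫ τ ≫ τ = 𝟙 C ∧ σ ≫ τ = τ ≫ σ ≫ σ ∧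
      (∀ P : ComplexPoints C, P ≫ σ ≠ P ∧ P ≫ τ ≠ P) ∧
      Module.finrank ℂ ↥(LinearMap.ker ((complexBetti.map τ 1).hom - 1) ⊓
        Module.End.eigenspace ((complexBetti.map σ 1).hom + (complexBetti.map σ 1).hom ^ 2 +
            (complexBetti.map σ 1).hom ^ 4 - (complexBetti.map σ 1).hom ^ 3 -
            (complexBetti.map σ 1).hom ^ 5 - (complexBetti.map σ 1).hom ^ 6)
          (Complex.I * (Real.sqrt (7 : ℝ) : ℂ)) ⊓ hodgeOneZero hC) = 6) :
    exists_heckePrymDatum_F21 := by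
  obtain ⟨C, hC, 𝒥, σ, τ, hdim, hσ, hτ, hστ, hfree, h6⟩ := h
  have hμ : Complex.I * (Real.sqrt (7 : ℝ) : ℂ) ≠ 0 :=
    mul_ne_zero Complex.I_ne_zero (Complex.ofReal_ne_zero.2 (Real.sqrt_pos.2 (by norm_num)).ne')
  refine exists_heckePrymDatum_F21_of_isIso_of_weilType hI
    ⟨C, 𝒥, σ, τ, hC, hdim, hσ, hτ, hστ, hfree, ?_⟩
  intro s t eN hs ht heN sB tB hsB htB φ' hφ' hP
  rw [finrank_eigenspace_inf_hodgeOneZero_heckePrym_eq 𝒥 hI hC hdim hσ hτ hστ hfree hs ht heN hsB htB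
    hφ' hP hμ]
  exact h6

/-- **`exists_heckePrymDatum_F21` from the two Jacobian facts and the étale `F₂₁`-curve of genus
`43` with its holomorphic Chevalley–Weil datum — the complete reduction.** Granted the named facts
`Motives.isIso_bettiCohomology_map_abelJacobi` (`H¹(J(C)) ≅ H¹(C)`; it implies `dim J = g`,
`Motives.two_mul_dim_eq_finrank_bettiCohomology_of_isIso`) and
`Motives.nonempty_jacobian_of_isSmoothProjective` (Jacobians exist, [Milne1986JacobianVarieties,
Thm. 1.1]): if there is a smooth projective complex curve `C` with `b₁(C(ℂ)) = 86` (genus `43`)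
and fixed-point-free automorphisms `σ⁷ = 𝟙`, `τ³ = 𝟙`, `σ ≫ τ = τ ≫ σ ≫ σ` (Riemann's existence
theorem for the generating vector `(σ, τ, 1; 1, 1, 1)` of `F₂₁` of type `(3; —)`,
[LangeRodriguez2022, Thm. 3.1.1]: an étale `F₂₁`-cover of a genus-3 curve) such that
`dim (H¹(C)^τ ∩ ker(η_C - i√7) ∩ H^{1,0}(C)) = 6` (the holomorphic Chevalley–Weil theorem,
[ChevalleyWeil1934Integrale]), THEN the named fact holds (`exists_heckePrymDatum_F21_of_isIso_of_curve`
with the chosen Jacobian `Motives.jacobian C _`, of dimension `½ b₁ = 43`). What the tree still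
lacks for the fact itself is thus exactly: the two Jacobian facts, Riemann's existence theorem for
`F₂₁`, and the holomorphic Chevalley–Weil multiplicity.
[cite: LangeRodriguez2022, Thm. 3.1.1 (PDF p. 52), §3.2 (3.5)–(3.6) (PDF p. 56) and §3.5 Cor. 3.5.9–3.5.10 (PDF pp. 70–71)]
[cite: Milne1986JacobianVarieties, Thm. 1.1, Prop. 2.1 and §6 Prop. 6.4]
[cite: ChevalleyWeil1934Integrale, Satz (pp. 358–361)] -/
theorem exists_heckePrymDatum_F21_of_isIso_of_nonempty_jacobian_of_curve
    (hI : Motives.isIso_bettiCohomology_map_abelJacobi)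
    (hJ : Motives.nonempty_jacobian_of_isSmoothProjective.{0})
    (h : ∃ (C : SchemeOver ℂ) (hC : IsSmoothProjective 1 C) (σ τ : C ⟶ C),
      Module.finrank ℂ (complexBetti C 1) = 86 ∧
      σ ≫ σ ≫ σ ≫ σ ≫ σ ≫ σ ≫ σ = 𝟙 C ∧ τ ≫ τ ≫ τ = 𝟙 C ∧ σ ≫ τ = τ ≫ σ ≫ σ ∧
      (∀ P : ComplexPoints C, P ≫ σ ≠ P ∧ P ≫ τ ≠ P) ∧
      Module.finrank ℂ ↥(LinearMap.ker ((complexBetti.map τ 1).hom - 1) ⊓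
        Module.End.eigenspace ((complexBetti.map σ 1).hom + (complexBetti.map σ 1).hom ^ 2 +
            (complexBetti.map σ 1).hom ^ 4 - (complexBetti.map σ 1).hom ^ 3 -
            (complexBetti.map σ 1).hom ^ 5 - (complexBetti.map σ 1).hom ^ 6)
          (Complex.I * (Real.sqrt (7 : ℝ) : ℂ)) ⊓ hodgeOneZero hC) = 6) :
    exists_heckePrymDatum_F21 := by
  obtain ⟨C, hC, σ, τ, h86, hσ, hτ, hστ, hfree, h6⟩ := h
  let 𝒥 : Jacobian C := Motives.jacobian C (hJ ℂ C hC)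
  have hdim : 𝒥.J.dim = 43 := by
    have h := Motives.two_mul_dim_eq_finrank_bettiCohomology_of_isIso hI C hC 𝒥
    rw [← finrank_complexBetti_eq_finrank_bettiCohomology, h86] at h
    omega
  exact exists_heckePrymDatum_F21_of_isIso_of_curve hI ⟨C, hC, 𝒥, σ, τ, hdim, hσ, hτ, hστ, hfree, h6⟩

end Assembly

end Literature.AlgebraicGeometry.HodgeTheory

end
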